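import Mathlib
import HarnessLib

/-!
# ζ(5) search — Families: coefficient asymptotics of powers of a positive polynomial, I — the TYPES expansion

HONEST FRAMING: systematic search; no irrationality claim unless certified.  Cell `pub-zeta5`, certifier 2
(cert-2 g9, 2026-08-22).  Elementary real analysis / algebra of polynomials with non-negative coefficients; no
conjecture node is used; nothing about `ζ(5)`; no number of record moves.

PURPOSE.  P2's CONJECTURE D (`Families/DualConstantTerm.LeadingCoeffRateIsDualDecay`) asks for the LIMIT
`log|Q(n·a)|/n → −log raySup(₈π₈; B, A)`.  By cert-2 g8's D-exact theorem (`Families/DualExactFullCone`) the left side is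
`log CT[Λ_aⁿ]/n` with `Λ_a = P_A(g)/g^B` a Laurent polynomial with non-negative coefficients, so Conjecture D is the
classical fact `lim (1/n) log [x^{nB}] P(x)ⁿ = log inf_{x>0} P(x)/x^B` for a polynomial `P ≥ 0` (coefficientwise) whose
support contains `B`.  This series of files (`CoeffAsymp*`) proves that fact in general (any number of variables, any
support); this first file is the combinatorial input — the method of TYPES:
* `poly S c = Σ_{α ∈ S} c_α x^α`; a TYPE of length `n` is `k : monomials → ℕ` supported in `S` with `Σ k = n`
  (`Finset.piAntidiag S n`), its exponent `typeExp S k = Σ k_α • α` and weight `typeWeight S c k = (n; k)·∏ c_α^{k_α}`;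
* **`poly_pow_eq`** / **`coeff_poly_pow`** — `(poly S c)ⁿ = Σ_k (n;k) ∏ c^k · x^{typeExp k}` (the multinomial theorem),
  hence `[x^β] polyⁿ = Σ_{k : typeExp k = β} typeWeight k`;
* `typeWeight_le_coeff` — ONE type bounds the coefficient from below (`c ≥ 0`);
* **`coeff_pow_le_tilt_pow`** — the TILTING upper bound `[x^{nB}] polyⁿ ≤ (Σ_{α ∈ F} c_α e^{(α−B)·u})ⁿ` for every
  `u ∈ ℝ^d` and every set `F ⊆ S` that carries all types of exponent `nB`.
Standard axioms only.
-/

noncomputable section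

open MvPolynomial Finset Real

namespace Summit.KontsevichZagierPeriods.Zeta5Search.Families.Cellular

namespace CoeffAsymp

variable {d : ℕ}

/-- The polynomial `Σ_{α ∈ S} c_α x^α` with coefficient function `c` on the finite set of monomials `S`. -/
def poly (S : Finset (Fin d →₀ ℕ)) (c : (Fin d →₀ ℕ) → ℝ) : MvPolynomial (Fin d) ℝ :=
  ∑ α ∈ S, monomial α (c α)

/-- The exponent `Σ_α k_α • α` of a type `k`. -/
def typeExp (S : Finset (Fin d →₀ ℕ)) (k : (Fin d →₀ ℕ) → ℕ) : Fin d →₀ ℕ :=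
  ∑ α ∈ S, k α • α

/-- The weight `(n; k) · ∏_α c_α^{k_α}` of a type `k` (`n = Σ k`). -/
def typeWeight (S : Finset (Fin d →₀ ℕ)) (c : (Fin d →₀ ℕ) → ℝ) (k : (Fin d →₀ ℕ) → ℕ) : ℝ :=
  (Nat.multinomial S k : ℝ) * ∏ α ∈ S, c α ^ k α

/-- The vector `α − B ∈ ℝ^d` of a monomial relative to the base exponent `B`. -/
def dvec (B α : Fin d →₀ ℕ) : Fin d → ℝ := fun i => (α i : ℝ) - (B i : ℝ)

/-- The dot product `(α − B) · u`. -/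
def dot (B α : Fin d →₀ ℕ) (u : Fin d → ℝ) : ℝ := ∑ i, dvec B α i * u i

/-- The TILT `Σ_{α ∈ F} c_α e^{(α − B)·u}` (`= P_F(e^u) / e^{B·u}`). -/
def tilt (F : Finset (Fin d →₀ ℕ)) (c : (Fin d →₀ ℕ) → ℝ) (B : Fin d →₀ ℕ) (u : Fin d → ℝ) : ℝ :=
  ∑ α ∈ F, c α * Real.exp (dot B α u)

/-! ## The multinomial expansion -/

/-- `∏_{α ∈ S} (c_α x^α)^{k_α} = (∏ c_α^{k_α}) x^{typeExp k}`. -/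
theorem prod_monomial_pow (S : Finset (Fin d →₀ ℕ)) (c : (Fin d →₀ ℕ) → ℝ) (k : (Fin d →₀ ℕ) → ℕ) :
    ∏ α ∈ S, monomial α (c α) ^ k α = monomial (typeExp S k) (∏ α ∈ S, c α ^ k α) := by
  classical
  unfold typeExp
  induction S using Finset.induction_on with
  | empty => simp
  | @insert a s ha ih =>
    rw [Finset.prod_insert ha, Finset.prod_insert ha, Finset.sum_insert ha, ih, monomial_pow, monomial_mul]

/-- **The types expansion**: `(poly S c)ⁿ = Σ_{k ∈ piAntidiag S n} (n;k) ∏ c^k · x^{typeExp k}`. -/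
theorem poly_pow_eq (S : Finset (Fin d →₀ ℕ)) (c : (Fin d →₀ ℕ) → ℝ) (n : ℕ) :
    poly S c ^ n = ∑ k ∈ S.piAntidiag n, monomial (typeExp S k) (typeWeight S c k) := by
  classical
  unfold poly typeWeight
  rw [Finset.sum_pow_eq_sum_piAntidiag]
  refine Finset.sum_congr rfl fun k _ => ?_
  rw [prod_monomial_pow, ← map_natCast (C : ℝ →+* MvPolynomial (Fin d) ℝ), C_mul_monomial]

/-- **`[x^β] polyⁿ = Σ_{k : typeExp k = β} typeWeight k`.** -/
theorem coeff_poly_pow (S : Finset (Fin d →₀ ℕ)) (c : (Fin d →₀ ℕ) → ℝ) (n : ℕ) (β : Fin d →₀ ℕ) :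
    coeff β (poly S c ^ n) = ∑ k ∈ S.piAntidiag n, if typeExp S k = β then typeWeight S c k else 0 := by
  classical
  rw [poly_pow_eq, coeff_sum]
  refine Finset.sum_congr rfl fun k _ => ?_
  rw [coeff_monomial]

/-- Type weights are non-negative when `c ≥ 0` on `S`. -/
theorem typeWeight_nonneg {S : Finset (Fin d →₀ ℕ)} {c : (Fin d →₀ ℕ) → ℝ} (hc : ∀ α ∈ S, 0 ≤ c α)
    (k : (Fin d →₀ ℕ) → ℕ) : 0 ≤ typeWeight S c k :=
  mul_nonneg (Nat.cast_nonneg _) (Finset.prod_nonneg fun α hα => pow_nonneg (hc α hα) _)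

/-- The coefficients of `polyⁿ` are non-negative when `c ≥ 0` on `S`. -/
theorem coeff_poly_pow_nonneg {S : Finset (Fin d →₀ ℕ)} {c : (Fin d →₀ ℕ) → ℝ} (hc : ∀ α ∈ S, 0 ≤ c α)
    (n : ℕ) (β : Fin d →₀ ℕ) : 0 ≤ coeff β (poly S c ^ n) := by
  rw [coeff_poly_pow]
  exact Finset.sum_nonneg fun k _ => by
    split_ifs
    · exact typeWeight_nonneg hc k
    · exact le_rfl

/-- **One type bounds the coefficient from below**: `typeWeight k ≤ [x^{typeExp k}] polyⁿ` for `k` of length `n`. -/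
theorem typeWeight_le_coeff {S : Finset (Fin d →₀ ℕ)} {c : (Fin d →₀ ℕ) → ℝ} (hc : ∀ α ∈ S, 0 ≤ c α)
    {n : ℕ} {k : (Fin d →₀ ℕ) → ℕ} (hk : k ∈ S.piAntidiag n) :
    typeWeight S c k ≤ coeff (typeExp S k) (poly S c ^ n) := by
  classical
  rw [coeff_poly_pow]
  have h := Finset.single_le_sum (f := fun k' => if typeExp S k' = typeExp S k then typeWeight S c k' else 0)
    (fun k' _ => by
      split_ifs
      · exact typeWeight_nonneg hc k'
      · exact le_rfl) hk
  simpa using h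

/-! ## Coordinates of the exponent of a type -/

/-- `(typeExp k) i = Σ_α k_α α_i`. -/
theorem typeExp_apply (S : Finset (Fin d →₀ ℕ)) (k : (Fin d →₀ ℕ) → ℕ) (i : Fin d) :
    typeExp S k i = ∑ α ∈ S, k α * α i := by
  unfold typeExp
  rw [Finsupp.finsetSum_apply]
  simp

/-- For a type of length `n` and exponent `n • B`: `Σ_α k_α (α − B)·u = 0`. -/
theorem sum_mul_dot_eq_zero {S : Finset (Fin d →₀ ℕ)} {n : ℕ} {k : (Fin d →₀ ℕ) → ℕ} {B : Fin d →₀ ℕ}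
    (hk : k ∈ S.piAntidiag n) (hkB : typeExp S k = n • B) (u : Fin d → ℝ) :
    ∑ α ∈ S, (k α : ℝ) * dot B α u = 0 := by
  rw [Finset.mem_piAntidiag] at hk
  have hsum : ∑ α ∈ S, (k α : ℝ) = n := by exact_mod_cast hk.1
  have hcoord : ∀ i, ∑ α ∈ S, (k α : ℝ) * ((α i : ℝ) - B i) = 0 := by
    intro i
    have h1 : ((typeExp S k i : ℕ) : ℝ) = ((n • B) i : ℕ) := by rw [hkB]
    rw [typeExp_apply] at h1
    simp only [Finsupp.smul_apply, smul_eq_mul, Nat.cast_sum, Nat.cast_mul] at h1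
    simp_rw [mul_sub, Finset.sum_sub_distrib, ← Finset.sum_mul, h1, hsum]
    ring
  unfold dot dvec
  calc ∑ α ∈ S, (k α : ℝ) * ∑ i, ((α i : ℝ) - B i) * u i
      = ∑ α ∈ S, ∑ i, (k α : ℝ) * (((α i : ℝ) - B i) * u i) := by simp_rw [Finset.mul_sum]
    _ = ∑ i, ∑ α ∈ S, (k α : ℝ) * (((α i : ℝ) - B i) * u i) := Finset.sum_comm
    _ = ∑ i, u i * ∑ α ∈ S, (k α : ℝ) * ((α i : ℝ) - B i) := by
        refine Finset.sum_congr rfl fun i _ => ?_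
        rw [Finset.mul_sum]
        exact Finset.sum_congr rfl fun α _ => by ring
    _ = 0 := by simp [hcoord]

/-! ## The tilting upper bound -/

/-- `∏_{α ∈ S} (c_α e^{t_α})^{k_α} = (∏ c_α^{k_α}) · e^{Σ k_α t_α}`. -/
theorem prod_mul_exp_pow (S : Finset (Fin d →₀ ℕ)) (c t : (Fin d →₀ ℕ) → ℝ) (k : (Fin d →₀ ℕ) → ℕ) :
    ∏ α ∈ S, (c α * Real.exp (t α)) ^ k α = (∏ α ∈ S, c α ^ k α) * Real.exp (∑ α ∈ S, (k α : ℝ) * t α) := by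
  rw [Real.exp_sum, ← Finset.prod_mul_distrib]
  refine Finset.prod_congr rfl fun α _ => ?_
  rw [mul_pow, ← Real.exp_nat_mul]

/-- **The tilting upper bound.**  If every type of length `n` and exponent `n • B` is supported in `F ⊆ S`, then for
every `u ∈ ℝ^d`: `[x^{nB}] (poly S c)ⁿ ≤ (Σ_{α ∈ F} c_α e^{(α − B)·u})ⁿ` (`c ≥ 0` on `S`). -/
theorem coeff_pow_le_tilt_pow {S F : Finset (Fin d →₀ ℕ)} {c : (Fin d →₀ ℕ) → ℝ} (hc : ∀ α ∈ S, 0 ≤ c α)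
    (hFS : F ⊆ S) {n : ℕ} {B : Fin d →₀ ℕ}
    (hF : ∀ k ∈ S.piAntidiag n, typeExp S k = n • B → ∀ α ∈ S, k α ≠ 0 → α ∈ F) (u : Fin d → ℝ) :
    coeff (n • B) (poly S c ^ n) ≤ tilt F c B u ^ n := by
  classical
  -- write the tilt as a sum over `S` of `f α = [α ∈ F] c_α e^{(α−B)·u}` and expand its power by types
  set f : (Fin d →₀ ℕ) → ℝ := fun α => if α ∈ F then c α * Real.exp (dot B α u) else 0 with hf
  have htilt : tilt F c B u = ∑ α ∈ S, f α := by
    unfold tilt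
    rw [hf]
    simp only
    rw [← Finset.sum_filter, Finset.filter_mem_eq_inter, Finset.inter_eq_right.2 hFS]
  rw [htilt, Finset.sum_pow_eq_sum_piAntidiag, coeff_poly_pow]
  refine Finset.sum_le_sum fun k hk => ?_
  have hterm_nonneg : 0 ≤ (Nat.multinomial S k : ℝ) * ∏ α ∈ S, f α ^ k α := by
    refine mul_nonneg (Nat.cast_nonneg _) (Finset.prod_nonneg fun α hα => pow_nonneg ?_ _)
    simp only [hf]
    split_ifs
    · exact mul_nonneg (hc α hα) (Real.exp_nonneg _)
    · exact le_rfl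
  split_ifs with hkB
  · -- the type is supported in `F`, so `f α ^ k α = (c α e^{…}) ^ k α` termwise and the exponents sum to `0`
    have hprod : ∏ α ∈ S, f α ^ k α = ∏ α ∈ S, (c α * Real.exp (dot B α u)) ^ k α := by
      refine Finset.prod_congr rfl fun α hα => ?_
      by_cases hkα : k α = 0
      · simp [hkα]
      · have hαF : α ∈ F := hF k hk hkB α hα hkα
        simp [hf, hαF]
    rw [hprod, prod_mul_exp_pow, sum_mul_dot_eq_zero hk hkB u, Real.exp_zero, mul_one]
    exact le_rfl
  · exact hterm_nonneg

end CoeffAsymp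



end Summit.KontsevichZagierPeriods.Zeta5Search.Families.Cellular
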